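/-
Copyright (c) 2026. All rights reserved.
Released under Apache 2.0 license as described in the file LICENSE.
-/
import Mathlib
import Literature.Combinatorics.Hinz2018.PerfectCodes
import Literature.Combinatorics.Hinz2018.RandomMovesPerfectReturnHolds

/-!
# Hinz–Klavžar–Petr, *The Tower of Hanoi* (2018), §2.2.2: Theorem 2.23 PROVED — the named facts
# `AlekseyevBergerII`, `AlekseyevBergerIII`, `AlekseyevBergerIV`, `AlekseyevBergerOneZero` and
# `Theorem_2_23` of `RandomMoves` DISCHARGED

What this file is: the discharges
* `AlekseyevBergerII_holds : AlekseyevBergerII` — from `0^n` by uniformly random legal moves to the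
  prescribed perfect state `2^n` takes `(3^n - 1)(5^n - 3^n)/(2·3^{n-1})` moves on average;
* `AlekseyevBergerIII_holds : AlekseyevBergerIII` — from a uniformly random state to some perfect
  state: `(5^n - 2·3^n + 1)/4` moves on average;
* `AlekseyevBergerIV_holds : AlekseyevBergerIV` — from a uniformly random state to the perfect
  state `0^n`: `((3^n - 1)(5^{n+1} - 2·3^{n+1}) + 5^n - 3^n)/(4·3^n)`;
* `AlekseyevBergerOneZero_holds : AlekseyevBergerOneZero` — from `0^{n-1}1` (smallest `n - 1`
  discs on peg `0`, the largest on peg `1`) to some perfect state: `(3/2)(5^{n-1} - 3^{n-1})`;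
* `Theorem_2_23_holds : Theorem_2_23` — the conjunction of the four formulas of Theorem 2.23
  (the first one, `AlekseyevBergerI_holds`, is `RandomMovesPerfectReturnHolds`),
all `n ≥ 1`, in the carpet's first-step (Dirichlet-problem) rendering of expectations
(`IsHittingSolution`, `IsTaskValue`, `IsMeanTaskValue` of `RandomMoves`). Nothing is (re)stated
here: no definition and no named fact is introduced; every auxiliary statement is a theorem proved
in this file.

THE PRINTED PROOF (book pp. 118–119, following Alekseyev–Berger, §3, Lemmas 1–4): renewal
identities for the random process on the three copies `T^{n-1} i` of `H_3^n` — the absorption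
probabilities `p_1, p_2` (from `0^n`) and `q_1, q_2, q_3` (from the bridge end `0^{n-1}1`) at the
three perfect states satisfy `q_3 = 2q_1`, `q_2 = 1 - 3q_1`, `(8 - 3p_1(n-1)) q_1(n) = 1`,
`p_1 = 5 q_1`, whence `q_1(n) = 1/(8 - 15 q_1(n-1))`, `p_2(n) = 3^{n-1}/(5^n - 3^n)` (Lemma 4),
and then `E_{½→a}(n) = 3^{n-1}/(2 p_2(n-1))`, `E_{r→a}(n) = E_{r→a}(n-1) + (2/3) E_{½→a}(n)`
(Lemma 1), `E_{1→3}(n) = E_{1→a}(n)/p_2(n)` (Lemma 2), `E_{r→1} = E_{r→a} + (2/3) E_{1→3}`.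

THE ROAD TAKEN HERE is the same architecture with the probabilistic renewal arguments replaced by
the uniqueness of solutions of Dirichlet problems on the finite graph `H_3^n` (the carpet has no
random process, only first-step equations), in the following order.
* §1 Dirichlet problems on `H_3^n` with boundary set containing a perfect state: maximum
  principle, uniqueness and existence for arbitrary boundary data and sources (injective hence
  surjective linear first-step operator), as in `RandomMovesPerfectReturnHolds`.
* §2–§3 Peg relabellings `g_σ` (`relabelIso` of `LinearTowerOfHanoi`) transport solutions; the
  harmonic measures `μ_k` of the three perfect states (`= [j = k]` at `j^n`, harmonic elsewhere)
  exist, satisfy `μ_k ∘ g_σ = μ_{σ⁻¹ k}` and `Σ_k μ_k = 1`. These are the absorption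
  probabilities of the text; `α_n := μ_0(0^{n-1}1)` plays the role of `p_1`, `1 - α_n = 2 p_2`.
* §4 Decomposition: a solution with source `s` equals the zero-boundary solution plus
  `Σ_k U(k^n) μ_k` (uniqueness).
* §5–§6 Self-similarity ((2.12), `adj_snoc_snoc_iff(_of_ne)` of `HanoiGraphs`, `perfectWord_succ` of
  `PerfectCodes`): inside copy `i`
  and away from its corners `k^{n} i` the neighbourhoods of `H_3^{n+1}` are those of `H_3^n`, the
  bridge ends `k^n i` (`k ≠ i`) have the extra bridge neighbour; hence the RESTRICTION FORMULA
  `U(r i) = Σ_k U(k^n i) μ_k(r)` for `U` harmonic off the perfect states of `H_3^{n+1}`, and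
  `h_{n+1}(r i) = h_n(r) + Σ_k h_{n+1}(k^n i) μ_k(r)` for the hitting times of the perfect states
  (the renewal identities of Lemmas 1 and 3).
* §7 The three bridge equations at `0^n 1` for `μ_0, μ_1, μ_2` of `H_3^{n+1}` (the text's system
  for `q_1, q_2, q_3`) and the value `α_{n+1} = α_n + (1 - α_n) q_2` give, by induction, the
  INVARIANT `(1 - α_n)(5^n - 3^n) = 2·3^{n-1}` (Lemma 4 in the form `p_2(n) = 3^{n-1}/(5^n - 3^n)`).
* §8 Kac's formula `Σ_{g ∼ 0^n} h_n(g) = 3^n - 3` (from `AlekseyevBergerI_holds`) at two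
  consecutive levels gives `b_{n+1} (1 - α_n) = 3^n` for the common value `b_{n+1}` of `h_{n+1}` at
  the six bridge ends, so `b_{n+1} = (3/2)(5^n - 3^n)`: `AlekseyevBergerOneZero_holds`.
* §9 Summing the restriction formula over the three copies: `S_{n+1} = 3 S_n + 2·3^n b_{n+1}` for
  `S_n = Σ_r h_n(r)`, so `S_n = 3^n (5^n - 2·3^n + 1)/4`: `AlekseyevBergerIII_holds`.
* §10 The hitting time `h^{2}` of `{2^n}` decomposes as `h_n + E (μ_0 + μ_1)` with
  `E = h^{2}(0^n) = h^{2}(1^n)`; its first-step equation at `0^n` reads `E (1 - α_n) = 3^n - 1`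
  (Lemma 2), so `E = (3^n - 1)(5^n - 3^n)/(2·3^{n-1})`: `AlekseyevBergerII_holds`.
* §11 `h^{0} = h^{2} ∘ g_{(0 2)}` and `Σ_r μ_k(r) = 3^{n-1}` give
  `Σ_r h^{0}(r) = S_n + 2·3^{n-1} E`: `AlekseyevBergerIV_holds`; §12 `Theorem_2_23_holds`.

## References
* [HinzKlavzarPetr2018] A. M. Hinz, S. Klavžar, C. Petr, *The Tower of Hanoi – Myths and Maths*,
  2nd ed., Birkhäuser (2018), Ch. 2 §2.2.2, Theorem 2.23 and its proof, pp. 118–119.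
* [AlekseyevBerger2016] M. A. Alekseyev, T. Berger, Solving the Tower of Hanoi with Random Moves,
  in: *The Mathematics of Various Entertaining Subjects*, Princeton (2016), Ch. 5
  (arXiv:1304.3780),
  §2 formulae (1)–(5) (`E_{r→a}`, `E_{1→3}`, `E_{1→a}`, `E_{½→a}`, `E_{r→1}`), §3 Lemmas 1–4.
-/

namespace Literature.Combinatorics.Hinz2018

open Finset

/-! ### §1 Dirichlet problems on `H_3^n`: uniqueness and existence for arbitrary data -/

/-- Maximum principle for the homogeneous first-step system (boundary set `A` containing a
perfect state): a solution is `≤ 0`. [folklore] -/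
private theorem dirichlet_homogeneous_le_zero {n : ℕ} {A : Set (Fin n → ZMod 3)} {j : ZMod 3}
    (hA : perfectWord n j ∈ A) {u : (Fin n → ZMod 3) → ℝ} (h0 : ∀ f ∈ A, u f = 0)
    (hh : ∀ f ∉ A, ((moveFinset n f).card : ℝ) * u f = ∑ g ∈ moveFinset n f, u g)
    (f : Fin n → ZMod 3) : u f ≤ 0 := by
  obtain ⟨f₀, -, hf₀⟩ := Finset.exists_max_image Finset.univ u ⟨f, Finset.mem_univ f⟩
  have hmax : ∀ g, u g ≤ u f₀ := fun g => hf₀ g (Finset.mem_univ g)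
  suffices hM : u f₀ ≤ 0 from (hmax f).trans hM
  by_contra hM
  rw [not_le] at hM
  have step : ∀ {f : Fin n → ZMod 3}, f ∉ A → (∀ g, u g ≤ u f) →
      ∀ g ∈ moveFinset n f, u g = u f := by
    intro f hf hmx g hg
    have key : ∑ x ∈ moveFinset n f, (u f - u x) = 0 := by
      rw [Finset.sum_sub_distrib, Finset.sum_const, nsmul_eq_mul, ← hh f hf, sub_self]
    have := (Finset.sum_eq_zero_iff_of_nonneg fun x _ => sub_nonneg.mpr (hmx x)).mp key g hg
    linarith
  have key : ∀ k, k ≤ p1Dist n (stateOf f₀) j →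
      p1WordPath n f₀ j k ∉ A ∧ u (p1WordPath n f₀ j k) = u f₀ := by
    intro k
    induction k with
    | zero =>
      intro _
      rw [p1WordPath_zero]
      refine ⟨fun hmem => ?_, rfl⟩
      rw [h0 f₀ hmem] at hM
      exact lt_irrefl 0 hM
    | succ k ih =>
      intro hk
      obtain ⟨hnot, heq⟩ := ih (by omega)
      have hmax' : ∀ g, u g ≤ u (p1WordPath n f₀ j k) := by rw [heq]; exact hmax
      have hstep := step hnot hmax' _ (p1WordPath_move n f₀ j (by omega))
      rw [heq] at hstep
      refine ⟨fun hmem => ?_, hstep⟩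
      rw [h0 _ hmem] at hstep
      rw [← hstep] at hM
      exact lt_irrefl 0 hM
  have hlast := (key _ le_rfl).1
  rw [p1WordPath_last] at hlast
  exact hlast hA

/-- **Uniqueness for Dirichlet problems**: two functions with the same boundary values on a
target `A` containing a perfect state and the same source off `A` coincide. [folklore] -/
private theorem dirichlet_unique {n : ℕ} {A : Set (Fin n → ZMod 3)} {j : ZMod 3}
    (hA : perfectWord n j ∈ A) {u v : (Fin n → ZMod 3) → ℝ} (hb : ∀ f ∈ A, u f = v f)
    (hs : ∀ f ∉ A, ((moveFinset n f).card : ℝ) * u f - ∑ g ∈ moveFinset n f, u g =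
      ((moveFinset n f).card : ℝ) * v f - ∑ g ∈ moveFinset n f, v g) : u = v := by
  have h0 : ∀ f ∈ A, (u - v) f = 0 := fun f hf => by simp [hb f hf]
  have hh : ∀ f ∉ A, ((moveFinset n f).card : ℝ) * (u - v) f =
      ∑ g ∈ moveFinset n f, (u - v) g := fun f hf => by
    simp only [Pi.sub_apply, Finset.sum_sub_distrib, mul_sub]
    linarith [hs f hf]
  have h0' : ∀ f ∈ A, (v - u) f = 0 := fun f hf => by simp [hb f hf]
  have hh' : ∀ f ∉ A, ((moveFinset n f).card : ℝ) * (v - u) f =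
      ∑ g ∈ moveFinset n f, (v - u) g := fun f hf => by
    simp only [Pi.sub_apply, Finset.sum_sub_distrib, mul_sub]
    linarith [hs f hf]
  funext f
  have h1 := dirichlet_homogeneous_le_zero hA h0 hh f
  have h2 := dirichlet_homogeneous_le_zero hA h0' hh' f
  simp only [Pi.sub_apply] at h1 h2
  linarith

/-- **Existence for Dirichlet problems**: for every target `A` containing a perfect state, every
boundary datum `φ` and every source `s` there is a function equal to `φ` on `A` with
`deg(f) u(f) - Σ_{g ∼ f} u(g) = s(f)` off `A` (the first-step operator is injective by the
maximum principle, hence surjective). [folklore] -/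
private theorem dirichlet_exists {n : ℕ} {A : Set (Fin n → ZMod 3)} {j : ZMod 3}
    (hA : perfectWord n j ∈ A) (φ s : (Fin n → ZMod 3) → ℝ) :
    ∃ u : (Fin n → ZMod 3) → ℝ, (∀ f ∈ A, u f = φ f) ∧
      ∀ f ∉ A, ((moveFinset n f).card : ℝ) * u f - ∑ g ∈ moveFinset n f, u g = s f := by
  classical
  let T : ((Fin n → ZMod 3) → ℝ) →ₗ[ℝ] ((Fin n → ZMod 3) → ℝ) :=
    { toFun := fun u f =>
        if f ∈ A then u f else ((moveFinset n f).card : ℝ) * u f - ∑ g ∈ moveFinset n f, u g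
      map_add' := by
        intro u v
        funext f
        simp only [Pi.add_apply]
        split_ifs
        · rfl
        · rw [Finset.sum_add_distrib]; ring
      map_smul' := by
        intro c u
        funext f
        simp only [Pi.smul_apply, smul_eq_mul, RingHom.id_apply]
        split_ifs
        · rfl
        · rw [mul_sub, Finset.mul_sum]; ring }
  have hT : ∀ u f, T u f =
      if f ∈ A then u f else ((moveFinset n f).card : ℝ) * u f - ∑ g ∈ moveFinset n f, u g :=
    fun _ _ => rfl
  have hinj : Function.Injective T := by
    intro u v huv
    refine dirichlet_unique hA (fun f hf => ?_) (fun f hf => ?_)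
    · have := congr_fun huv f
      rwa [hT, hT, if_pos hf, if_pos hf] at this
    · have := congr_fun huv f
      rwa [hT, hT, if_neg hf, if_neg hf] at this
  obtain ⟨u, hu⟩ :=
    (LinearMap.injective_iff_surjective.mp hinj) (fun f => if f ∈ A then φ f else s f)
  refine ⟨u, fun f hf => ?_, fun f hf => ?_⟩
  · have := congr_fun hu f
    rwa [hT, if_pos hf, if_pos hf] at this
  · have := congr_fun hu f
    rwa [hT, if_neg hf, if_neg hf] at this

/-- The perfect word `k^n` lies in the set of perfect states. [folklore] -/
private theorem perfectWord_mem (n : ℕ) (k : ZMod 3) : perfectWord n k ∈ perfectWords n := ⟨k, rfl⟩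

/-- Existence of the first-step (hitting-time) solution for any target containing a perfect
state. [folklore] -/
private theorem exists_hitting {n : ℕ} {A : Set (Fin n → ZMod 3)} {j : ZMod 3}
    (hA : perfectWord n j ∈ A) : ∃ h, IsHittingSolution n A h := by
  obtain ⟨u, hu0, hus⟩ :=
    dirichlet_exists hA (fun _ => 0) (fun f => ((moveFinset n f).card : ℝ))
  exact ⟨u, fun f hf => hu0 f hf, fun f hf => by linarith [hus f hf]⟩

/-! ### §2 Relabelling the pegs -/

/-- The inverse of `g_σ` relabels by `σ⁻¹`. [folklore] -/
private theorem relabelIso_symm_apply' {n : ℕ} (σ : Equiv.Perm (ZMod 3)) (f : Fin n → ZMod 3) :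
    (relabelIso n σ).symm f = fun d => σ.symm (f d) := rfl

/-- `g_σ` maps the neighbourhood of `f` onto that of `g_σ f`. [folklore] -/
private theorem moveFinset_relabelIso' {n : ℕ} (σ : Equiv.Perm (ZMod 3)) (f : Fin n → ZMod 3) :
    moveFinset n (relabelIso n σ f) = (moveFinset n f).image (relabelIso n σ) := by
  ext g
  rw [mem_moveFinset_iff_adj, Finset.mem_image]
  constructor
  · intro hadj
    refine ⟨(relabelIso n σ).symm g, ?_, RelIso.apply_symm_apply _ g⟩
    rw [mem_moveFinset_iff_adj, ← (relabelIso n σ).map_adj_iff, RelIso.apply_symm_apply]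
    exact hadj
  · rintro ⟨g', hg', rfl⟩
    rw [mem_moveFinset_iff_adj] at hg'
    exact ((relabelIso n σ).map_adj_iff).mpr hg'

/-- Relabelling preserves degrees. [folklore] -/
private theorem card_moveFinset_relabelIso' {n : ℕ} (σ : Equiv.Perm (ZMod 3))
    (f : Fin n → ZMod 3) :
    (moveFinset n (relabelIso n σ f)).card = (moveFinset n f).card := by
  rw [moveFinset_relabelIso', Finset.card_image_of_injective _ (relabelIso n σ).injective]

/-- Neighbour sums transported along `g_σ`. [folklore] -/
private theorem sum_moveFinset_relabelIso' {n : ℕ} (σ : Equiv.Perm (ZMod 3))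
    (f : Fin n → ZMod 3) (h : (Fin n → ZMod 3) → ℝ) :
    ∑ g ∈ moveFinset n (relabelIso n σ f), h g = ∑ g ∈ moveFinset n f, h (relabelIso n σ g) := by
  rw [moveFinset_relabelIso', Finset.sum_image fun x _ y _ hxy => (relabelIso n σ).injective hxy]

/-- `g_σ` permutes the perfect states. [folklore] -/
private theorem relabelIso_mem_perfectWords_iff' {n : ℕ} (σ : Equiv.Perm (ZMod 3))
    (f : Fin n → ZMod 3) : relabelIso n σ f ∈ perfectWords n ↔ f ∈ perfectWords n := by
  constructor
  · rintro ⟨m, hm⟩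
    refine ⟨σ.symm m, ?_⟩
    have : f = (relabelIso n σ).symm (perfectWord n m) := by
      rw [hm, RelIso.symm_apply_apply]
    rw [this, relabelIso_symm_apply']
    rfl
  · rintro ⟨m, rfl⟩
    exact ⟨σ m, (relabelIso_perfectWord σ m).symm⟩

/-- Transport of first-step solutions: if `h` solves the system for the target `A`, then
`h ∘ g_σ` solves it for the target `g_σ⁻¹ A`. [folklore] -/
private theorem isHittingSolution_comp {n : ℕ} (σ : Equiv.Perm (ZMod 3))
    {A B : Set (Fin n → ZMod 3)} (hAB : ∀ f, f ∈ B ↔ relabelIso n σ f ∈ A)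
    {h : (Fin n → ZMod 3) → ℝ} (H : IsHittingSolution n A h) :
    IsHittingSolution n B (fun f => h (relabelIso n σ f)) := by
  refine ⟨fun f hf => H.1 _ ((hAB f).mp hf), fun f hf => ?_⟩
  have hf' : relabelIso n σ f ∉ A := fun h' => hf ((hAB f).mpr h')
  have := H.2 _ hf'
  rwa [card_moveFinset_relabelIso', sum_moveFinset_relabelIso'] at this

/-- The first-step solution for the perfect states is invariant under relabelling. [folklore] -/
private theorem hitting_perfect_relabel {n : ℕ} (σ : Equiv.Perm (ZMod 3))
    {h : (Fin n → ZMod 3) → ℝ} (H : IsHittingSolution n (perfectWords n) h)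
    (f : Fin n → ZMod 3) : h (relabelIso n σ f) = h f :=
  congr_fun (hittingSolution_unique (perfectWord_mem n 0)
    (isHittingSolution_comp σ (fun f => (relabelIso_mem_perfectWords_iff' σ f).symm) H) H) f

/-! ### §3 Harmonic measures of the three perfect states -/

/-- Harmonic functions with boundary data on the perfect states transport along `g_σ`: if `u` is
harmonic off the perfect states, so is `u ∘ g_σ`. [folklore] -/
private theorem harmonic_comp {n : ℕ} (σ : Equiv.Perm (ZMod 3)) {u : (Fin n → ZMod 3) → ℝ}
    (hu : ∀ f ∉ perfectWords n, ((moveFinset n f).card : ℝ) * u f = ∑ g ∈ moveFinset n f, u g)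
    (f : Fin n → ZMod 3) (hf : f ∉ perfectWords n) :
    ((moveFinset n f).card : ℝ) * u (relabelIso n σ f) =
      ∑ g ∈ moveFinset n f, u (relabelIso n σ g) := by
  have hf' : relabelIso n σ f ∉ perfectWords n :=
    fun h' => hf ((relabelIso_mem_perfectWords_iff' σ f).mp h')
  have := hu _ hf'
  rwa [card_moveFinset_relabelIso', sum_moveFinset_relabelIso'] at this

/-- **Symmetry of harmonic measures**: `μ_k(g_σ f) = μ_{σ⁻¹ k}(f)`. [folklore] -/
private theorem harmonicMeasure_relabel {n : ℕ} {μ : ZMod 3 → (Fin n → ZMod 3) → ℝ}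
    (hμb : ∀ k j, μ k (perfectWord n j) = if j = k then 1 else 0)
    (hμh : ∀ k, ∀ f ∉ perfectWords n,
      ((moveFinset n f).card : ℝ) * μ k f = ∑ g ∈ moveFinset n f, μ k g)
    (σ : Equiv.Perm (ZMod 3)) (k : ZMod 3) (f : Fin n → ZMod 3) :
    μ k (relabelIso n σ f) = μ (σ.symm k) f := by
  have key : (fun f => μ k (relabelIso n σ f)) = μ (σ.symm k) := by
    refine dirichlet_unique (A := perfectWords n) (perfectWord_mem n 0) ?_ ?_
    · rintro f ⟨m, rfl⟩
      simp only [relabelIso_perfectWord, hμb]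
      by_cases hm : m = σ.symm k
      · subst hm; simp
      · rw [if_neg hm, if_neg (fun h' => hm (by rw [← h']; simp))]
    · intro f hf
      show ((moveFinset n f).card : ℝ) * μ k (relabelIso n σ f) -
          ∑ g ∈ moveFinset n f, μ k (relabelIso n σ g) = _
      rw [harmonic_comp σ (hμh k) f hf, hμh (σ.symm k) f hf, sub_self, sub_self]
  exact congr_fun key f

/-- The three harmonic measures sum to `1`. [folklore] -/
private theorem harmonicMeasure_sum {n : ℕ} {μ : ZMod 3 → (Fin n → ZMod 3) → ℝ}
    (hμb : ∀ k j, μ k (perfectWord n j) = if j = k then 1 else 0)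
    (hμh : ∀ k, ∀ f ∉ perfectWords n,
      ((moveFinset n f).card : ℝ) * μ k f = ∑ g ∈ moveFinset n f, μ k g)
    (f : Fin n → ZMod 3) : ∑ k, μ k f = 1 := by
  have key : (fun f => ∑ k, μ k f) = fun _ => 1 := by
    refine dirichlet_unique (A := perfectWords n) (perfectWord_mem n 0) ?_ ?_
    · rintro f ⟨m, rfl⟩
      simp only [hμb, Finset.sum_ite_eq, Finset.mem_univ, if_true]
    · intro f hf
      simp only [Finset.mul_sum, Finset.sum_const, nsmul_eq_mul, mul_one]
      rw [Finset.sum_comm]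
      simp only [← hμh _ f hf, sub_self]
  exact congr_fun key f

/-- Existence of the harmonic measures `μ_k` (`= 1` at `k^n`, `= 0` at the other perfect states,
harmonic elsewhere), `n ≥ 1`. [folklore] -/
private theorem exists_harmonicMeasure {n : ℕ} (hn : 1 ≤ n) :
    ∃ μ : ZMod 3 → (Fin n → ZMod 3) → ℝ,
      (∀ k j, μ k (perfectWord n j) = if j = k then 1 else 0) ∧
      ∀ k, ∀ f ∉ perfectWords n,
        ((moveFinset n f).card : ℝ) * μ k f = ∑ g ∈ moveFinset n f, μ k g := by
  have H : ∀ k : ZMod 3, ∃ u : (Fin n → ZMod 3) → ℝ,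
      (∀ j, u (perfectWord n j) = if j = k then 1 else 0) ∧
      ∀ f ∉ perfectWords n, ((moveFinset n f).card : ℝ) * u f = ∑ g ∈ moveFinset n f, u g := by
    intro k
    obtain ⟨u, hub, hus⟩ := dirichlet_exists (A := perfectWords n) (perfectWord_mem n 0)
      (fun f => if f = perfectWord n k then 1 else 0) (fun _ => 0)
    refine ⟨u, fun j => ?_, fun f hf => by linarith [hus f hf]⟩
    rw [hub _ (perfectWord_mem n j)]
    by_cases hjk : j = k
    · subst hjk; simp
    · rw [if_neg hjk, if_neg fun h' => hjk (perfectWord_injective hn h')]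
  choose μ hμ using H
  exact ⟨μ, fun k => (hμ k).1, fun k => (hμ k).2⟩

/-! ### §4 Decomposition by boundary values -/

/-- **Decomposition lemma**: a solution `U` of the first-step system with source `s` off the
perfect states is the zero-boundary solution `w` plus the combination `Σ_k U(k^n) μ_k` of the
harmonic measures. [folklore] -/
private theorem dirichlet_decomposition {n : ℕ} {μ : ZMod 3 → (Fin n → ZMod 3) → ℝ}
    (hμb : ∀ k j, μ k (perfectWord n j) = if j = k then 1 else 0)
    (hμh : ∀ k, ∀ f ∉ perfectWords n,
      ((moveFinset n f).card : ℝ) * μ k f = ∑ g ∈ moveFinset n f, μ k g)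
    {U w s : (Fin n → ZMod 3) → ℝ} (hw0 : ∀ f ∈ perfectWords n, w f = 0)
    (hws : ∀ f ∉ perfectWords n,
      ((moveFinset n f).card : ℝ) * w f - ∑ g ∈ moveFinset n f, w g = s f)
    (hUs : ∀ f ∉ perfectWords n,
      ((moveFinset n f).card : ℝ) * U f - ∑ g ∈ moveFinset n f, U g = s f)
    (f : Fin n → ZMod 3) : U f = w f + ∑ k, U (perfectWord n k) * μ k f := by
  have key : U = fun f => w f + ∑ k, U (perfectWord n k) * μ k f := by
    refine dirichlet_unique (A := perfectWords n) (perfectWord_mem n 0) ?_ ?_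
    · rintro f ⟨m, rfl⟩
      simp only [hw0 _ (perfectWord_mem n m), hμb, mul_ite, mul_one, mul_zero,
        Finset.sum_ite_eq, Finset.mem_univ, if_true, zero_add]
    · intro f hf
      have hsum : ∑ g ∈ moveFinset n f, (w g + ∑ k, U (perfectWord n k) * μ k g) =
          ∑ g ∈ moveFinset n f, w g +
            ((moveFinset n f).card : ℝ) * ∑ k, U (perfectWord n k) * μ k f := by
        rw [Finset.sum_add_distrib, Finset.sum_comm, Finset.mul_sum]
        congr 1
        refine Finset.sum_congr rfl fun k _ => ?_
        rw [← Finset.mul_sum, ← hμh k f hf]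
        ring
      show _ = ((moveFinset n f).card : ℝ) * (w f + ∑ k, U (perfectWord n k) * μ k f) -
        ∑ g ∈ moveFinset n f, (w g + ∑ k, U (perfectWord n k) * μ k g)
      rw [hsum, hUs f hf, ← hws f hf]
      ring
  exact congr_fun key f

/-! ### §5 The recursive structure: `H_3^{n+1}` as three copies of `H_3^n` -/

/-- `r i` is a perfect state iff `r = i^n`. [folklore] -/
private theorem snoc_mem_perfectWords_iff {n : ℕ} (r : Fin n → ZMod 3) (i : ZMod 3) :
    (Fin.snoc r i : Fin (n + 1) → ZMod 3) ∈ perfectWords (n + 1) ↔ r = perfectWord n i := by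
  constructor
  · rintro ⟨k, hk⟩
    rw [perfectWord_succ] at hk
    obtain ⟨h1, h2⟩ := Fin.snoc_inj.mp hk
    rw [← h1, h2]
  · rintro rfl
    exact ⟨i, perfectWord_succ i⟩

/-- The neighbours of `r i` in `H_3^{n+1}`: the neighbours of `r` in `H_3^n` with the largest
disc kept on peg `i`, and — when `r = k^n`, `k ≠ i` — the move of the largest disc to the third
peg ((2.12)). [folklore] -/
private theorem mem_moveFinset_snoc {n : ℕ} {r : Fin n → ZMod 3} {i : ZMod 3}
    {g : Fin (n + 1) → ZMod 3} :
    g ∈ moveFinset (n + 1) (Fin.snoc r i : Fin (n + 1) → ZMod 3) ↔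
      (∃ s ∈ moveFinset n r, g = Fin.snoc s i) ∨
      (∃ j, j ≠ i ∧ r = perfectWord n (thirdPeg i j) ∧ g = Fin.snoc r j) := by
  rw [mem_moveFinset_iff_adj, eq_snoc g]
  by_cases hj : g (Fin.last n) = i
  · rw [hj, adj_snoc_snoc_iff]
    constructor
    · intro hadj
      exact Or.inl ⟨Fin.init g, mem_moveFinset_iff_adj.mpr hadj, rfl⟩
    · rintro (⟨s, hs, hgs⟩ | ⟨j, hji, -, hgj⟩)
      · rw [(Fin.snoc_inj.mp hgs).1]
        exact mem_moveFinset_iff_adj.mp hs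
      · exact absurd (Fin.snoc_inj.mp hgj).2 hji.symm
  · rw [adj_snoc_snoc_iff_of_ne (Ne.symm hj)]
    constructor
    · rintro ⟨hr, hs⟩
      exact Or.inr ⟨g (Fin.last n), hj, hr, by rw [hs, hr]⟩
    · rintro (⟨s, -, hgs⟩ | ⟨j, -, hr, hgj⟩)
      · exact absurd (Fin.snoc_inj.mp hgs).2 hj
      · obtain ⟨h1, h2⟩ := Fin.snoc_inj.mp hgj
        subst h2
        exact ⟨hr, h1.trans hr⟩

/-- Inside a copy, away from its corners, the neighbourhood is that of `H_3^n`. [folklore] -/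
private theorem moveFinset_snoc_of_not_mem {n : ℕ} {r : Fin n → ZMod 3} (hr : r ∉ perfectWords n)
    (i : ZMod 3) :
    moveFinset (n + 1) (Fin.snoc r i : Fin (n + 1) → ZMod 3) =
      (moveFinset n r).image (fun s => (Fin.snoc s i : Fin (n + 1) → ZMod 3)) := by
  ext g
  rw [mem_moveFinset_snoc, Finset.mem_image]
  constructor
  · rintro (⟨s, hs, rfl⟩ | ⟨j, -, hrj, -⟩)
    · exact ⟨s, hs, rfl⟩
    · exact absurd ⟨_, hrj.symm⟩ hr
  · rintro ⟨s, hs, rfl⟩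
    exact Or.inl ⟨s, hs, rfl⟩

/-- Degrees inside a copy, away from its corners. [folklore] -/
private theorem card_moveFinset_snoc_of_not_mem {n : ℕ} {r : Fin n → ZMod 3}
    (hr : r ∉ perfectWords n) (i : ZMod 3) :
    (moveFinset (n + 1) (Fin.snoc r i : Fin (n + 1) → ZMod 3)).card = (moveFinset n r).card := by
  have hinj : Function.Injective
      (fun s : Fin n → ZMod 3 => (Fin.snoc s i : Fin (n + 1) → ZMod 3)) :=
    fun x y hxy => (Fin.snoc_inj.mp hxy).1
  rw [moveFinset_snoc_of_not_mem hr, Finset.card_image_of_injective _ hinj]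

/-- Neighbour sums inside a copy, away from its corners. [folklore] -/
private theorem sum_moveFinset_snoc_of_not_mem {n : ℕ} {r : Fin n → ZMod 3}
    (hr : r ∉ perfectWords n) (i : ZMod 3) (F : (Fin (n + 1) → ZMod 3) → ℝ) :
    ∑ g ∈ moveFinset (n + 1) (Fin.snoc r i : Fin (n + 1) → ZMod 3), F g =
      ∑ s ∈ moveFinset n r, F (Fin.snoc s i) := by
  rw [moveFinset_snoc_of_not_mem hr]
  refine Finset.sum_image ?_
  intro x _ y _ hxy
  exact (Fin.snoc_inj.mp hxy).1

/-- The neighbourhood of a bridge end `k^n i` (`k ≠ i`, `n ≥ 1`): the two inner neighbours and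
the bridge to `k^n j`, `j` the third peg. [folklore] -/
private theorem moveFinset_snoc_perfectWord {n : ℕ} (hn : 1 ≤ n) {k i : ZMod 3} (hki : k ≠ i) :
    moveFinset (n + 1) (Fin.snoc (perfectWord n k) i : Fin (n + 1) → ZMod 3) =
      insert (Fin.snoc (perfectWord n k) (thirdPeg i k) : Fin (n + 1) → ZMod 3)
        ((moveFinset n (perfectWord n k)).image
          (fun s => (Fin.snoc s i : Fin (n + 1) → ZMod 3))) := by
  ext g
  rw [mem_moveFinset_snoc, Finset.mem_insert, Finset.mem_image]
  have hik : i ≠ k := hki.symm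
  constructor
  · rintro (⟨s, hs, rfl⟩ | ⟨j, hji, hrj, rfl⟩)
    · exact Or.inr ⟨s, hs, rfl⟩
    · left
      have hkj : k = thirdPeg i j := perfectWord_injective hn hrj
      subst hkj
      rw [(thirdPeg_thirdPeg (Ne.symm hji)).1]
  · rintro (rfl | ⟨s, hs, rfl⟩)
    · refine Or.inr ⟨thirdPeg i k, (thirdPeg_spec i k hik).1, ?_, rfl⟩
      rw [(thirdPeg_thirdPeg hik).1]
    · exact Or.inl ⟨s, hs, rfl⟩

/-- Neighbour sums at a bridge end `k^n i` (`k ≠ i`, `n ≥ 1`). [folklore] -/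
private theorem sum_moveFinset_bridgeEnd {n : ℕ} (hn : 1 ≤ n) {k i : ZMod 3} (hki : k ≠ i)
    (F : (Fin (n + 1) → ZMod 3) → ℝ) :
    ∑ g ∈ moveFinset (n + 1) (Fin.snoc (perfectWord n k) i : Fin (n + 1) → ZMod 3), F g =
      F (Fin.snoc (perfectWord n k) (thirdPeg i k)) +
        ∑ s ∈ moveFinset n (perfectWord n k), F (Fin.snoc s i) := by
  have hnot : (Fin.snoc (perfectWord n k) (thirdPeg i k) : Fin (n + 1) → ZMod 3) ∉
      (moveFinset n (perfectWord n k)).image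
        (fun s => (Fin.snoc s i : Fin (n + 1) → ZMod 3)) := by
    rw [Finset.mem_image]
    rintro ⟨s, -, hs⟩
    exact (thirdPeg_spec i k hki.symm).1 (Fin.snoc_inj.mp hs).2.symm
  have hinj : ∀ x ∈ moveFinset n (perfectWord n k), ∀ y ∈ moveFinset n (perfectWord n k),
      (Fin.snoc x i : Fin (n + 1) → ZMod 3) = Fin.snoc y i → x = y :=
    fun x _ y _ hxy => (Fin.snoc_inj.mp hxy).1
  rw [moveFinset_snoc_perfectWord hn hki, Finset.sum_insert hnot, Finset.sum_image hinj]

/-- A bridge end `k^n i` (`k ≠ i`, `n ≥ 1`) is not a perfect state. [folklore] -/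
private theorem snoc_perfectWord_not_mem {n : ℕ} (hn : 1 ≤ n) {k i : ZMod 3} (hki : k ≠ i) :
    (Fin.snoc (perfectWord n k) i : Fin (n + 1) → ZMod 3) ∉ perfectWords (n + 1) := fun h =>
  hki (perfectWord_injective hn ((snoc_mem_perfectWords_iff _ _).mp h))

/-- Relabelling commutes with the copy embeddings: `g_σ (r a) = (g_σ r) (σ a)`. [folklore] -/
private theorem relabelIso_snoc {n : ℕ} (σ : Equiv.Perm (ZMod 3)) (r : Fin n → ZMod 3)
    (a : ZMod 3) :
    relabelIso (n + 1) σ (Fin.snoc r a : Fin (n + 1) → ZMod 3) =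
      (Fin.snoc (relabelIso n σ r) (σ a) : Fin (n + 1) → ZMod 3) := by
  funext d
  rw [relabelIso_apply, relabelIso_apply]
  induction d using Fin.lastCases with
  | last => simp only [Fin.snoc_last]
  | cast d => simp only [Fin.snoc_castSucc]

/-- Sums over `ZMod 3`. [folklore] -/
private theorem sum_univ_zmod3 (F : ZMod 3 → ℝ) : ∑ k, F k = F 0 + F 1 + F 2 :=
  Fin.sum_univ_three F

/-- Splitting a sum over `H_3^{n+1}` along the three copies of `H_3^n`. [folklore] -/
private theorem sum_snoc {n : ℕ} (F : (Fin (n + 1) → ZMod 3) → ℝ) :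
    ∑ f, F f = ∑ i : ZMod 3, ∑ r : Fin n → ZMod 3, F (Fin.snoc r i) := by
  rw [← (Fin.snocEquiv fun _ => ZMod 3).sum_comp, Fintype.sum_prod_type]
  rfl

/-- Degree `3` off the perfect states (real form). [folklore] -/
private theorem card_moveFinset_of_not_mem' {n : ℕ} {f : Fin n → ZMod 3}
    (hf : f ∉ perfectWords n) : ((moveFinset n f).card : ℝ) = 3 := by
  rw [← degree_eq_card_moveFinset, degree_of_not_mem_perfectWords hf]
  norm_num

/-- Degree `2` at the perfect states (real form). [folklore] -/
private theorem card_moveFinset_perfectWord' {n : ℕ} (hn : 1 ≤ n) (k : ZMod 3) :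
    ((moveFinset n (perfectWord n k)).card : ℝ) = 2 := by
  rw [← degree_eq_card_moveFinset, degree_perfectWord hn]
  norm_num

/-- The two neighbours of `0^n` are `0^{n-1}1` and `0^{n-1}2`. [folklore] -/
private theorem sum_moveFinset_perfectWord_zero_eq {n : ℕ} (hn : 1 ≤ n)
    (G : (Fin n → ZMod 3) → ℝ) :
    ∑ s ∈ moveFinset n (perfectWord n 0), G s =
      G (Function.update (perfectWord n 0) ⟨0, hn⟩ 1) +
        G (Function.update (perfectWord n 0) ⟨0, hn⟩ 2) := by
  rw [← neighborFinset_eq_moveFinset,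
    neighborFinset_of_mem_perfectWords hn (perfectWord_mem n 0),
    Finset.sum_image fun a _ b _ hab => Function.update_injective _ _ hab,
    show perfectWord n 0 ⟨0, hn⟩ = 0 from rfl, Finset.sum_erase_eq_sub (Finset.mem_univ _),
    sum_univ_zmod3]
  ring

/-- In `H_3^{n+1}` (`n ≥ 1`) the neighbours of `0^{n+1}` lie in copy `0`:
`0^{n+1}` updated at the smallest disc is `(0^n updated) 0`. [folklore] -/
private theorem update_perfectWord_succ {n : ℕ} (hn : 1 ≤ n) (a : ZMod 3) :
    Function.update (perfectWord (n + 1) 0) ⟨0, Nat.succ_pos n⟩ a =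
      (Fin.snoc (Function.update (perfectWord n 0) ⟨0, hn⟩ a) 0 : Fin (n + 1) → ZMod 3) := by
  funext d
  induction d using Fin.lastCases with
  | last =>
    rw [Fin.snoc_last, Function.update_of_ne]
    · rfl
    · intro h
      have := congrArg Fin.val h
      simp at this
      omega
  | cast d =>
    rw [Fin.snoc_castSucc]
    by_cases hd : d = ⟨0, hn⟩
    · subst hd
      rw [Function.update_self]
      exact Function.update_self ..
    · rw [Function.update_of_ne hd, Function.update_of_ne]
      · rfl
      · intro h
        exact hd (Fin.ext (by simpa using congrArg Fin.val h))

/-- Kac's formula for the perfect states (from Theorem 2.23, first formula):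
`Σ_{g ∼ 0^n} h(g) = 3^n − 3`. [folklore] -/
private theorem kac_sum {n : ℕ} (hn : 1 ≤ n) {h : (Fin n → ZMod 3) → ℝ}
    (H : IsHittingSolution n (perfectWords n) h) :
    ∑ g ∈ moveFinset n (perfectWord n 0), h g = (3 : ℝ) ^ n - 3 := by
  obtain ⟨h', H', hv⟩ := AlekseyevBergerI_holds n hn
  rw [hittingSolution_unique (perfectWord_mem n 0) H H']
  rw [card_moveFinset_perfectWord' hn] at hv
  linarith

/-! ### §6 Restriction to a copy -/

/-- **Restriction formula**: a function harmonic off the perfect states of `H_3^{n+1}`,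
restricted to copy `i`, is the combination of the harmonic measures of `H_3^n` weighted by its
values at the corners `k^n i` of the copy. [folklore] -/
private theorem harmonic_snoc_eq {n : ℕ} {μ : ZMod 3 → (Fin n → ZMod 3) → ℝ}
    (hμb : ∀ k j, μ k (perfectWord n j) = if j = k then 1 else 0)
    (hμh : ∀ k, ∀ f ∉ perfectWords n,
      ((moveFinset n f).card : ℝ) * μ k f = ∑ g ∈ moveFinset n f, μ k g)
    {U : (Fin (n + 1) → ZMod 3) → ℝ}
    (hU : ∀ f ∉ perfectWords (n + 1),
      ((moveFinset (n + 1) f).card : ℝ) * U f = ∑ g ∈ moveFinset (n + 1) f, U g)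
    (i : ZMod 3) (r : Fin n → ZMod 3) :
    U (Fin.snoc r i) = ∑ k, U (Fin.snoc (perfectWord n k) i) * μ k r := by
  have h := dirichlet_decomposition hμb hμh
    (U := fun r => U (Fin.snoc r i : Fin (n + 1) → ZMod 3))
    (w := fun _ => 0) (s := fun _ => 0) (fun _ _ => rfl) (fun f _ => by simp) ?_ r
  · simpa only [zero_add] using h
  · intro f hf
    have hf' : (Fin.snoc f i : Fin (n + 1) → ZMod 3) ∉ perfectWords (n + 1) := fun hmem =>
      hf (by rw [(snoc_mem_perfectWords_iff f i).mp hmem]; exact perfectWord_mem n i)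
    show ((moveFinset n f).card : ℝ) * U (Fin.snoc f i) -
        ∑ g ∈ moveFinset n f, U (Fin.snoc g i) = 0
    rw [← card_moveFinset_snoc_of_not_mem hf i, ← sum_moveFinset_snoc_of_not_mem hf i U,
      hU _ hf', sub_self]

/-- **Restriction formula for the hitting time** of the perfect states: on copy `i`,
`h_{n+1}(r i) = h_n(r) + Σ_k h_{n+1}(k^n i) μ_k(r)`. [folklore] -/
private theorem hitting_snoc_eq {n : ℕ} {μ : ZMod 3 → (Fin n → ZMod 3) → ℝ}
    (hμb : ∀ k j, μ k (perfectWord n j) = if j = k then 1 else 0)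
    (hμh : ∀ k, ∀ f ∉ perfectWords n,
      ((moveFinset n f).card : ℝ) * μ k f = ∑ g ∈ moveFinset n f, μ k g)
    {hN : (Fin (n + 1) → ZMod 3) → ℝ} (HN : IsHittingSolution (n + 1) (perfectWords (n + 1)) hN)
    {h : (Fin n → ZMod 3) → ℝ} (H : IsHittingSolution n (perfectWords n) h)
    (i : ZMod 3) (r : Fin n → ZMod 3) :
    hN (Fin.snoc r i) = h r + ∑ k, hN (Fin.snoc (perfectWord n k) i) * μ k r := by
  refine dirichlet_decomposition hμb hμh
    (U := fun r => hN (Fin.snoc r i : Fin (n + 1) → ZMod 3))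
    (w := h) (s := fun f => ((moveFinset n f).card : ℝ)) H.1
    (fun f hf => by linarith [H.2 f hf]) ?_ r
  intro f hf
  have hf' : (Fin.snoc f i : Fin (n + 1) → ZMod 3) ∉ perfectWords (n + 1) := fun hmem =>
    hf (by rw [(snoc_mem_perfectWords_iff f i).mp hmem]; exact perfectWord_mem n i)
  show ((moveFinset n f).card : ℝ) * hN (Fin.snoc f i) -
      ∑ g ∈ moveFinset n f, hN (Fin.snoc g i) = ((moveFinset n f).card : ℝ)
  rw [← card_moveFinset_snoc_of_not_mem hf i, ← sum_moveFinset_snoc_of_not_mem hf i hN,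
    HN.2 _ hf']
  ring

/-- `μ_{σ k}(g_σ f) = μ_k(f)`. [folklore] -/
private theorem harmonicMeasure_relabel' {n : ℕ} {μ : ZMod 3 → (Fin n → ZMod 3) → ℝ}
    (hμb : ∀ k j, μ k (perfectWord n j) = if j = k then 1 else 0)
    (hμh : ∀ k, ∀ f ∉ perfectWords n,
      ((moveFinset n f).card : ℝ) * μ k f = ∑ g ∈ moveFinset n f, μ k g)
    (σ : Equiv.Perm (ZMod 3)) (k : ZMod 3) (f : Fin n → ZMod 3) :
    μ (σ k) (relabelIso n σ f) = μ k f := by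
  rw [harmonicMeasure_relabel hμb hμh, Equiv.symm_apply_apply]

/-! ### §7 The harmonic measures near a perfect state, and the invariant `α_n` -/

/-- The harmonic measures summed over the two neighbours `0^{n-1}1`, `0^{n-1}2` of `0^n`, in
terms of `α_n := μ_0(0^{n-1}1)`: `2α_n`, `1 - α_n`, `1 - α_n`; and
`μ_1(0^{n-1}1) + μ_2(0^{n-1}1) = 1 - α_n`. [folklore] -/
private theorem corner_measure_sums {n : ℕ} (hn : 1 ≤ n) {μ : ZMod 3 → (Fin n → ZMod 3) → ℝ}
    (hμb : ∀ k j, μ k (perfectWord n j) = if j = k then 1 else 0)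
    (hμh : ∀ k, ∀ f ∉ perfectWords n,
      ((moveFinset n f).card : ℝ) * μ k f = ∑ g ∈ moveFinset n f, μ k g) :
    (∑ s ∈ moveFinset n (perfectWord n 0), μ 0 s =
        2 * μ 0 (Function.update (perfectWord n 0) ⟨0, hn⟩ 1)) ∧
      (∑ s ∈ moveFinset n (perfectWord n 0), μ 1 s =
        1 - μ 0 (Function.update (perfectWord n 0) ⟨0, hn⟩ 1)) ∧
      (∑ s ∈ moveFinset n (perfectWord n 0), μ 2 s =
        1 - μ 0 (Function.update (perfectWord n 0) ⟨0, hn⟩ 1)) ∧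
      μ 1 (Function.update (perfectWord n 0) ⟨0, hn⟩ 1) +
          μ 2 (Function.update (perfectWord n 0) ⟨0, hn⟩ 1) =
        1 - μ 0 (Function.update (perfectWord n 0) ⟨0, hn⟩ 1) := by
  have he : relabelIso n (Equiv.swap 1 2) (Function.update (perfectWord n 0) ⟨0, hn⟩ 1) =
      Function.update (perfectWord n 0) ⟨0, hn⟩ 2 := by
    funext d
    show Equiv.swap (1 : ZMod 3) 2 (Function.update (perfectWord n 0) ⟨0, hn⟩ 1 d) =
      Function.update (perfectWord n 0) ⟨0, hn⟩ 2 d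
    by_cases hd : d = ⟨0, hn⟩
    · subst hd
      rw [Function.update_self, Function.update_self]
      exact Equiv.swap_apply_left _ _
    · rw [Function.update_of_ne hd, Function.update_of_ne hd]
      show Equiv.swap (1 : ZMod 3) 2 0 = 0
      decide
  have hrel := harmonicMeasure_relabel hμb hμh (Equiv.swap 1 2)
  have h0 : μ 0 (Function.update (perfectWord n 0) ⟨0, hn⟩ 2) =
      μ 0 (Function.update (perfectWord n 0) ⟨0, hn⟩ 1) := by
    rw [← he, hrel, Equiv.symm_swap, show Equiv.swap (1 : ZMod 3) 2 0 = 0 by decide]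
  have h1 : μ 1 (Function.update (perfectWord n 0) ⟨0, hn⟩ 2) =
      μ 2 (Function.update (perfectWord n 0) ⟨0, hn⟩ 1) := by
    rw [← he, hrel, Equiv.symm_swap, Equiv.swap_apply_left]
  have h2 : μ 2 (Function.update (perfectWord n 0) ⟨0, hn⟩ 2) =
      μ 1 (Function.update (perfectWord n 0) ⟨0, hn⟩ 1) := by
    rw [← he, hrel, Equiv.symm_swap, Equiv.swap_apply_right]
  have hs := harmonicMeasure_sum hμb hμh (Function.update (perfectWord n 0) ⟨0, hn⟩ 1)
  simp only [sum_univ_zmod3] at hs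
  refine ⟨?_, ?_, ?_, by linarith⟩
  · rw [sum_moveFinset_perfectWord_zero_eq hn, h0]; ring
  · rw [sum_moveFinset_perfectWord_zero_eq hn, h1]; linarith
  · rw [sum_moveFinset_perfectWord_zero_eq hn, h2]; linarith

/-- **The invariant** of the harmonic measures: with `α_n := μ_0(0^{n-1}1)`,
`(1 - α_n)(5^n - 3^n) = 2·3^{n-1}` (`n ≥ 1`), i.e. `1 - α_n = 2·3^{n-1}/(5^n - 3^n)`
(equivalently Alekseyev–Berger's `p_2(n) = 3^{n-1}/(5^n - 3^n)`), proved by the renormalisation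
step `α_{n+1} = 5/(8 - 3α_n)` through the three bridge equations. [folklore] -/
private theorem alpha_identity (m : ℕ) {M : ZMod 3 → (Fin (m + 1) → ZMod 3) → ℝ}
    (hMb : ∀ k j, M k (perfectWord (m + 1) j) = if j = k then 1 else 0)
    (hMh : ∀ k, ∀ f ∉ perfectWords (m + 1),
      ((moveFinset (m + 1) f).card : ℝ) * M k f = ∑ g ∈ moveFinset (m + 1) f, M k g) :
    (1 - M 0 (Function.update (perfectWord (m + 1) 0) ⟨0, Nat.succ_pos m⟩ 1)) *
        ((5 : ℝ) ^ (m + 1) - 3 ^ (m + 1)) = 2 * 3 ^ m := by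
  induction m with
  | zero =>
    have h1 : Function.update (perfectWord (0 + 1) 0) ⟨0, Nat.succ_pos 0⟩ 1 =
        perfectWord (0 + 1) 1 := by
      funext d
      have hd : d = ⟨0, Nat.succ_pos 0⟩ := Fin.ext (by omega)
      subst hd
      rw [Function.update_self]
      rfl
    rw [h1, hMb, if_neg (show ¬ ((1 : ZMod 3) = 0) by decide)]
    norm_num
  | succ m ih =>
    obtain ⟨μ, hμb, hμh⟩ := exists_harmonicMeasure (Nat.succ_pos m)
    have hI := ih hμb hμh
    obtain ⟨hν0, hν1, hν2, hs⟩ := corner_measure_sums (Nat.succ_pos m) hμb hμh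
    rw [update_perfectWord_succ (Nat.succ_pos m) 1]
    -- swap values
    have s120 : Equiv.swap (1 : ZMod 3) 2 0 = 0 := by decide
    have s020 : Equiv.swap (0 : ZMod 3) 2 0 = 2 := by decide
    have s021 : Equiv.swap (0 : ZMod 3) 2 1 = 1 := by decide
    have s022 : Equiv.swap (0 : ZMod 3) 2 2 = 0 := by decide
    have h3 : thirdPeg (1 : ZMod 3) 0 = 2 := by decide
    -- the bridge end `B = 0^{m+1} 1` and its images
    have hB : (Fin.snoc (perfectWord (m + 1) 0) 1 : Fin (m + 1 + 1) → ZMod 3) ∉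
        perfectWords (m + 1 + 1) :=
      snoc_perfectWord_not_mem (Nat.succ_pos m) (by decide)
    have hB' : relabelIso (m + 1 + 1) (Equiv.swap 0 2)
        (Fin.snoc (perfectWord (m + 1) 0) 1 : Fin (m + 1 + 1) → ZMod 3) =
        Fin.snoc (perfectWord (m + 1) 2) 1 := by
      rw [relabelIso_snoc, relabelIso_perfectWord, Equiv.swap_apply_left, s021]
    have hB2 : relabelIso (m + 1 + 1) (Equiv.swap 1 2)
        (Fin.snoc (perfectWord (m + 1) 0) 1 : Fin (m + 1 + 1) → ZMod 3) =
        Fin.snoc (perfectWord (m + 1) 0) 2 := by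
      rw [relabelIso_snoc, relabelIso_perfectWord, s120, Equiv.swap_apply_left]
    have hC1 : relabelIso (m + 1 + 1) (Equiv.swap 0 1)
        (Fin.snoc (perfectWord (m + 1) 0) 1 : Fin (m + 1 + 1) → ZMod 3) =
        Fin.snoc (perfectWord (m + 1) 1) 0 := by
      rw [relabelIso_snoc, relabelIso_perfectWord, Equiv.swap_apply_left, Equiv.swap_apply_right]
    have hC2 : relabelIso (m + 1 + 1) (Equiv.swap 0 1 * Equiv.swap 0 2)
        (Fin.snoc (perfectWord (m + 1) 0) 1 : Fin (m + 1 + 1) → ZMod 3) =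
        Fin.snoc (perfectWord (m + 1) 2) 0 := by
      rw [relabelIso_snoc, relabelIso_perfectWord,
        show (Equiv.swap (0 : ZMod 3) 1 * Equiv.swap 0 2 : Equiv.Perm (ZMod 3)) 0 = (2 : ZMod 3)
          by decide,
        show (Equiv.swap (0 : ZMod 3) 1 * Equiv.swap 0 2 : Equiv.Perm (ZMod 3)) 1 = (0 : ZMod 3)
          by decide]
    have hB'val : ∀ j, M j (Fin.snoc (perfectWord (m + 1) 2) 1) =
        M (Equiv.swap 0 2 j) (Fin.snoc (perfectWord (m + 1) 0) 1) := fun j => by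
      rw [← hB', harmonicMeasure_relabel hMb hMh, Equiv.symm_swap]
    have hB2val : ∀ j, M j (Fin.snoc (perfectWord (m + 1) 0) 2) =
        M (Equiv.swap 1 2 j) (Fin.snoc (perfectWord (m + 1) 0) 1) := fun j => by
      rw [← hB2, harmonicMeasure_relabel hMb hMh, Equiv.symm_swap]
    have hc00 : M 0 (Fin.snoc (perfectWord (m + 1) 0) 0) = 1 := by
      rw [← perfectWord_succ, hMb, if_pos rfl]
    have hc10 : M 0 (Fin.snoc (perfectWord (m + 1) 1) 0) =
        M 1 (Fin.snoc (perfectWord (m + 1) 0) 1) := by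
      rw [← hC1, harmonicMeasure_relabel hMb hMh, Equiv.symm_swap, Equiv.swap_apply_left]
    have hc20 : M 0 (Fin.snoc (perfectWord (m + 1) 2) 0) =
        M 1 (Fin.snoc (perfectWord (m + 1) 0) 1) := by
      rw [← hC2, harmonicMeasure_relabel hMb hMh,
        show (Equiv.swap (0 : ZMod 3) 1 * Equiv.swap 0 2 : Equiv.Perm (ZMod 3)).symm 0 =
          (1 : ZMod 3) by decide]
    -- the bridge equations at `B`, for the three harmonic measures
    have hbridge : ∀ j, 3 * M j (Fin.snoc (perfectWord (m + 1) 0) 1) =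
        M (Equiv.swap 1 2 j) (Fin.snoc (perfectWord (m + 1) 0) 1) +
          (M j (Fin.snoc (perfectWord (m + 1) 0) 1) *
              (2 * μ 0 (Function.update (perfectWord (m + 1) 0) ⟨0, Nat.succ_pos m⟩ 1)) +
            (if (1 : ZMod 3) = j then 1 else 0) *
              (1 - μ 0 (Function.update (perfectWord (m + 1) 0) ⟨0, Nat.succ_pos m⟩ 1)) +
            M (Equiv.swap 0 2 j) (Fin.snoc (perfectWord (m + 1) 0) 1) *
              (1 - μ 0 (Function.update (perfectWord (m + 1) 0) ⟨0, Nat.succ_pos m⟩ 1))) := by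
      intro j
      have h1 := hMh j _ hB
      rw [card_moveFinset_of_not_mem' hB,
        sum_moveFinset_bridgeEnd (Nat.succ_pos m) (show (0 : ZMod 3) ≠ 1 by decide) (M j),
        h3, hB2val] at h1
      have h2 : ∑ s ∈ moveFinset (m + 1) (perfectWord (m + 1) 0),
          M j (Fin.snoc s 1 : Fin (m + 1 + 1) → ZMod 3) =
          M j (Fin.snoc (perfectWord (m + 1) 0) 1) *
              (2 * μ 0 (Function.update (perfectWord (m + 1) 0) ⟨0, Nat.succ_pos m⟩ 1)) +
            (if (1 : ZMod 3) = j then 1 else 0) *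
              (1 - μ 0 (Function.update (perfectWord (m + 1) 0) ⟨0, Nat.succ_pos m⟩ 1)) +
            M (Equiv.swap 0 2 j) (Fin.snoc (perfectWord (m + 1) 0) 1) *
              (1 - μ 0 (Function.update (perfectWord (m + 1) 0) ⟨0, Nat.succ_pos m⟩ 1)) := by
        rw [Finset.sum_congr rfl fun s _ => harmonic_snoc_eq hμb hμh (hMh j) 1 s,
          Finset.sum_comm]
        simp only [← Finset.mul_sum]
        rw [sum_univ_zmod3, hν0, hν1, hν2, ← perfectWord_succ, hMb, hB'val]
      rw [h2] at h1
      exact h1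
    have hE0 := hbridge 0
    rw [s120, s020, if_neg (show ¬ ((1 : ZMod 3) = 0) by decide)] at hE0
    have hE1 := hbridge 1
    rw [Equiv.swap_apply_left, s021, if_pos rfl] at hE1
    have hE2 := hbridge 2
    rw [Equiv.swap_apply_right, s022, if_neg (show ¬ ((1 : ZMod 3) = 2) by decide)] at hE2
    -- the value `α_{m+2} = M_0(e₁ 0)`
    have hα' : M 0 (Fin.snoc (Function.update (perfectWord (m + 1) 0) ⟨0, Nat.succ_pos m⟩ 1) 0) =
        M 0 (Fin.snoc (perfectWord (m + 1) 0) 0) *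
            μ 0 (Function.update (perfectWord (m + 1) 0) ⟨0, Nat.succ_pos m⟩ 1) +
          M 0 (Fin.snoc (perfectWord (m + 1) 1) 0) *
            μ 1 (Function.update (perfectWord (m + 1) 0) ⟨0, Nat.succ_pos m⟩ 1) +
          M 0 (Fin.snoc (perfectWord (m + 1) 2) 0) *
            μ 2 (Function.update (perfectWord (m + 1) 0) ⟨0, Nat.succ_pos m⟩ 1) := by
      rw [harmonic_snoc_eq hμb hμh (hMh 0) 0, sum_univ_zmod3]
    rw [hc00, hc10, hc20] at hα'
    -- algebra
    set α := μ 0 (Function.update (perfectWord (m + 1) 0) ⟨0, Nat.succ_pos m⟩ 1) with hα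
    set β := μ 1 (Function.update (perfectWord (m + 1) 0) ⟨0, Nat.succ_pos m⟩ 1) with hβ
    set γ := μ 2 (Function.update (perfectWord (m + 1) 0) ⟨0, Nat.succ_pos m⟩ 1) with hγ
    set q₁ := M 0 (Fin.snoc (perfectWord (m + 1) 0) 1 : Fin (m + 1 + 1) → ZMod 3) with hq₁
    set q₂ := M 1 (Fin.snoc (perfectWord (m + 1) 0) 1 : Fin (m + 1 + 1) → ZMod 3) with hq₂
    set q₃ := M 2 (Fin.snoc (perfectWord (m + 1) 0) 1 : Fin (m + 1 + 1) → ZMod 3) with hq₃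
    set α' := M 0 (Fin.snoc (Function.update (perfectWord (m + 1) 0) ⟨0, Nat.succ_pos m⟩ 1) 0 :
      Fin (m + 1 + 1) → ZMod 3) with hα'def
    have h1α : (1 : ℝ) - α ≠ 0 := by
      intro h0
      rw [h0, zero_mul] at hI
      have : (0 : ℝ) < 2 * 3 ^ m := by positivity
      linarith
    have hq3 : q₃ = 2 * q₁ := by
      have h0 : (1 - α) * (q₃ - 2 * q₁) = 0 := by linear_combination -hE0
      rcases mul_eq_zero.mp h0 with h | h
      · exact absurd h h1α
      · linarith
    have hq2 : q₂ = (5 - 3 * α) * q₁ := by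
      linear_combination (-1 : ℝ) * hE2 + (3 - 2 * α) * hq3
    have hC : (8 - 3 * α) * q₁ = 1 := by
      have h0 : (1 - α) * ((8 - 3 * α) * q₁ - 1) = 0 := by
        linear_combination hE1 + hq3 - (2 - α) * hq2
      rcases mul_eq_zero.mp h0 with h | h
      · exact absurd h h1α
      · linarith
    have hA' : 1 - α' = 3 * q₁ * (1 - α) := by
      linear_combination (-1 : ℝ) * hα' - q₂ * hs - (1 - α) * hq2 - (1 - α) * hC
    linear_combination (5 * 5 ^ (m + 1) - 9 * 3 ^ m) * hA' + (15 * q₁) * hI + (6 * 3 ^ m) * hC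

/-! ### §8 The hitting time of the perfect states at a bridge end (Alekseyev–Berger's `½ → a`) -/

/-- For `k ≠ i` there is a relabelling with `σ 0 = k`, `σ 1 = i`. [folklore] -/
private theorem exists_perm_zero_one {k i : ZMod 3} (hki : k ≠ i) :
    ∃ σ : Equiv.Perm (ZMod 3), σ 0 = k ∧ σ 1 = i := by
  refine ⟨Equiv.swap 0 k * Equiv.swap 1 (Equiv.swap 0 k i), ?_, ?_⟩
  · rw [Equiv.Perm.mul_apply, Equiv.swap_apply_of_ne_of_ne (show (0 : ZMod 3) ≠ 1 by decide),
      Equiv.swap_apply_left]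
    intro h
    rw [eq_comm, Equiv.swap_apply_eq_iff, Equiv.swap_apply_left] at h
    exact hki h.symm
  · rw [Equiv.Perm.mul_apply, Equiv.swap_apply_left, Equiv.swap_apply_self]

/-- The constant sums over the state space: `|T^n| = 3^n`. [folklore] -/
private theorem sum_const_words (n : ℕ) (c : ℝ) : ∑ _r : Fin n → ZMod 3, c = 3 ^ n * c := by
  rw [Finset.sum_const, Finset.card_univ, Fintype.card_fun, ZMod.card, Fintype.card_fin,
    nsmul_eq_mul]
  push_cast
  ring

/-- Each harmonic measure has total mass `3^{n-1}` (`n ≥ 1`). [folklore] -/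
private theorem sum_measure (m : ℕ) {μ : ZMod 3 → (Fin (m + 1) → ZMod 3) → ℝ}
    (hμb : ∀ k j, μ k (perfectWord (m + 1) j) = if j = k then 1 else 0)
    (hμh : ∀ k, ∀ f ∉ perfectWords (m + 1),
      ((moveFinset (m + 1) f).card : ℝ) * μ k f = ∑ g ∈ moveFinset (m + 1) f, μ k g)
    (k : ZMod 3) : ∑ r, μ k r = 3 ^ m := by
  have hk : ∀ k, ∑ r, μ k r = ∑ r, μ 0 r := by
    intro k
    have h1 : ∑ r, μ k (relabelIso (m + 1) (Equiv.swap 0 k) r) = ∑ r, μ k r :=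
      Fintype.sum_equiv (relabelIso (m + 1) (Equiv.swap 0 k)).toEquiv _ _ fun _ => rfl
    rw [← h1]
    refine Finset.sum_congr rfl fun r _ => ?_
    rw [harmonicMeasure_relabel hμb hμh, Equiv.symm_swap, Equiv.swap_apply_right]
  have htot : ∑ k, ∑ r, μ k r = 3 ^ (m + 1) := by
    rw [Finset.sum_comm, Finset.sum_congr rfl fun r _ => harmonicMeasure_sum hμb hμh r,
      sum_const_words, mul_one]
  rw [Finset.sum_congr rfl fun k _ => hk k, Finset.sum_const, Finset.card_univ, ZMod.card,
    nsmul_eq_mul, pow_succ] at htot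
  rw [hk k]
  push_cast at htot
  linarith

/-- The hitting time of the perfect states takes the same value `b_{n+1}` at all six bridge
ends `k^n i`, `k ≠ i`. [folklore] -/
private theorem hitting_bridgeEnd_eq {n : ℕ} {hN : (Fin (n + 1) → ZMod 3) → ℝ}
    (HN : IsHittingSolution (n + 1) (perfectWords (n + 1)) hN) {k i : ZMod 3} (hki : k ≠ i) :
    hN (Fin.snoc (perfectWord n k) i) = hN (Fin.snoc (perfectWord n 0) 1) := by
  obtain ⟨σ, h0, h1⟩ := exists_perm_zero_one hki
  have : relabelIso (n + 1) σ (Fin.snoc (perfectWord n 0) 1 : Fin (n + 1) → ZMod 3) =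
      Fin.snoc (perfectWord n k) i := by
    rw [relabelIso_snoc, relabelIso_perfectWord, h0, h1]
  rw [← this, hitting_perfect_relabel σ HN]

/-- The hitting time of the perfect states at the corners `k^n i` of copy `i`:
`0` at the perfect state `i^{n+1}`, `b_{n+1}` at the two bridge ends. [folklore] -/
private theorem hitting_copyCorner {n : ℕ} {hN : (Fin (n + 1) → ZMod 3) → ℝ}
    (HN : IsHittingSolution (n + 1) (perfectWords (n + 1)) hN) (k i : ZMod 3) :
    hN (Fin.snoc (perfectWord n k) i) =
      if k = i then 0 else hN (Fin.snoc (perfectWord n 0) 1) := by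
  by_cases hki : k = i
  · subst hki
    rw [if_pos rfl, ← perfectWord_succ, HN.1 _ (perfectWord_mem (n + 1) k)]
  · rw [if_neg hki, hitting_bridgeEnd_eq HN hki]

/-- On copy `i`: `Σ_k h_{n+1}(k^n i) μ_k(r) = b_{n+1} (1 - μ_i(r))`. [folklore] -/
private theorem hitting_copy_boundary_sum {n : ℕ} {μ : ZMod 3 → (Fin n → ZMod 3) → ℝ}
    (hμb : ∀ k j, μ k (perfectWord n j) = if j = k then 1 else 0)
    (hμh : ∀ k, ∀ f ∉ perfectWords n,
      ((moveFinset n f).card : ℝ) * μ k f = ∑ g ∈ moveFinset n f, μ k g)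
    {hN : (Fin (n + 1) → ZMod 3) → ℝ}
    (HN : IsHittingSolution (n + 1) (perfectWords (n + 1)) hN) (i : ZMod 3) (r : Fin n → ZMod 3) :
    ∑ k, hN (Fin.snoc (perfectWord n k) i) * μ k r =
      hN (Fin.snoc (perfectWord n 0) 1) * (1 - μ i r) := by
  have h1 : ∀ k, hN (Fin.snoc (perfectWord n k) i) * μ k r =
      hN (Fin.snoc (perfectWord n 0) 1) * μ k r -
        if k = i then hN (Fin.snoc (perfectWord n 0) 1) * μ k r else 0 := by
    intro k
    rw [hitting_copyCorner HN k i]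
    split_ifs <;> ring
  rw [Finset.sum_congr rfl fun k _ => h1 k, Finset.sum_sub_distrib, Finset.sum_ite_eq',
    if_pos (Finset.mem_univ _), ← Finset.mul_sum, harmonicMeasure_sum hμb hμh r]
  ring

/-- **The value at the bridge end**: `h_{n+1}(0^n 1) = (3/2)(5^n - 3^n)` (`n ≥ 1`), from Kac's
formula at the two levels and the invariant `α_n`. [folklore] -/
private theorem oneZero_value (m : ℕ) {hN : (Fin (m + 1 + 1) → ZMod 3) → ℝ}
    (HN : IsHittingSolution (m + 1 + 1) (perfectWords (m + 1 + 1)) hN) :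
    hN (Fin.snoc (perfectWord (m + 1) 0) 1) = 3 * ((5 : ℝ) ^ (m + 1) - 3 ^ (m + 1)) / 2 := by
  have hn : 1 ≤ m + 1 := Nat.succ_pos m
  have hn' : 1 ≤ m + 1 + 1 := Nat.succ_pos (m + 1)
  obtain ⟨μ, hμb, hμh⟩ := exists_harmonicMeasure hn
  have hI := alpha_identity m hμb hμh
  obtain ⟨hν0, -, -, -⟩ := corner_measure_sums hn hμb hμh
  obtain ⟨h, H⟩ := exists_hitting (A := perfectWords (m + 1)) (perfectWord_mem (m + 1) 0)
  have hk1 := kac_sum hn H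
  have hk2 := kac_sum hn' HN
  rw [sum_moveFinset_perfectWord_zero_eq hn',
    update_perfectWord_succ hn, update_perfectWord_succ hn,
    hitting_snoc_eq hμb hμh HN H, hitting_snoc_eq hμb hμh HN H,
    hitting_copy_boundary_sum hμb hμh HN, hitting_copy_boundary_sum hμb hμh HN] at hk2
  rw [sum_moveFinset_perfectWord_zero_eq hn] at hk1 hν0
  -- `b (1 - α) = 3^{m+1}`
  set b := hN (Fin.snoc (perfectWord (m + 1) 0) 1) with hb
  have hb1 : b * (1 - μ 0 (Function.update (perfectWord (m + 1) 0) ⟨0, hn⟩ 1)) =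
      3 ^ (m + 1) := by
    rw [pow_succ] at hk2
    linear_combination (1 / 2 : ℝ) * hk2 - (1 / 2 : ℝ) * hk1 + (b / 2) * hν0
  have h3 : (3 : ℝ) ^ m ≠ 0 := by positivity
  rw [eq_div_iff (by norm_num : (2 : ℝ) ≠ 0)]
  apply mul_right_cancel₀ h3
  linear_combination ((5 : ℝ) ^ (m + 1) - 3 ^ (m + 1)) * hb1 - b * hI

/-- `0^{n-1}1` for `n ≥ 2` is the bridge end `0^{n-1} 1` of copy `1`. [folklore] -/
private theorem oneZeroWord_succ_succ (m : ℕ) :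
    oneZeroWord (m + 1 + 1) = Fin.snoc (perfectWord (m + 1) 0) 1 := by
  funext d
  induction d using Fin.lastCases with
  | last => simp [oneZeroWord, Fin.snoc_last]
  | cast d =>
    rw [Fin.snoc_castSucc]
    have hd : ¬ ((Fin.castSucc d).val + 1 = m + 1 + 1) := by simp; omega
    show (if (Fin.castSucc d).val + 1 = m + 1 + 1 then (1 : ZMod 3) else 0) =
      perfectWord (m + 1) 0 d
    rw [if_neg hd]
    rfl

/-- `oneZeroWord 1 = 1^1` is a perfect state. [folklore] -/
private theorem oneZeroWord_one : oneZeroWord 1 = perfectWord 1 1 := by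
  funext d
  have hd : d = 0 := Fin.ext (by omega)
  subst hd
  simp [oneZeroWord, perfectWord]

/-- **Alekseyev–Berger's `E(0^{n-1}1 → perfect) = (3/2)(5^{n-1} - 3^{n-1})`, HOLDS** —
discharge of the named fact `AlekseyevBergerOneZero` (the book's `d_e(10^{n-1}, i^n)`; Puzzle
`½ → a` of Alekseyev–Berger, *Solving the Tower of Hanoi with random moves* (2016), §2 (4), §3).
[cite: HinzKlavzarPetr2018, Ch. 2 §2.2.2 Thm. 2.23 (p. 118)] -/
theorem AlekseyevBergerOneZero_holds : AlekseyevBergerOneZero := by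
  intro n hn
  obtain ⟨h, H⟩ := exists_hitting (A := perfectWords n) (perfectWord_mem n 0)
  refine ⟨h, H, ?_⟩
  obtain ⟨m, rfl⟩ : ∃ m, n = m + 1 := ⟨n - 1, by omega⟩
  cases m with
  | zero =>
    rw [oneZeroWord_one, H.1 _ (perfectWord_mem 1 1)]
    norm_num
  | succ m =>
    rw [oneZeroWord_succ_succ, oneZero_value m H, Nat.add_sub_cancel]

/-! ### §9 Theorem 2.23, third formula: the mean over all starting states -/

/-- `Σ_r h_n(r) = 3^n (5^n - 2·3^n + 1)/4` (`n ≥ 1`), by the recursion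
`S_{n+1} = 3 S_n + 2·3^n b_{n+1}` over the three copies. [folklore] -/
private theorem sum_hitting (m : ℕ) {h : (Fin (m + 1) → ZMod 3) → ℝ}
    (H : IsHittingSolution (m + 1) (perfectWords (m + 1)) h) :
    ∑ r, h r = 3 ^ (m + 1) * ((5 : ℝ) ^ (m + 1) - 2 * 3 ^ (m + 1) + 1) / 4 := by
  induction m with
  | zero =>
    have h0 : ∀ r : Fin (0 + 1) → ZMod 3, h r = 0 := fun r => H.1 r ⟨r 0, by
      funext d
      have hd : d = 0 := Fin.ext (by omega)
      subst hd
      rfl⟩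
    simp only [h0, Finset.sum_const_zero]
    norm_num
  | succ m ih =>
    obtain ⟨μ, hμb, hμh⟩ := exists_harmonicMeasure (Nat.succ_pos m)
    obtain ⟨g, G⟩ := exists_hitting (A := perfectWords (m + 1)) (perfectWord_mem (m + 1) 0)
    have hS := ih G
    have hb := oneZero_value m H
    have inner : ∀ i : ZMod 3, ∑ r : Fin (m + 1) → ZMod 3, h (Fin.snoc r i) =
        ∑ r : Fin (m + 1) → ZMod 3, g r +
          h (Fin.snoc (perfectWord (m + 1) 0) 1) * (3 ^ (m + 1) - 3 ^ m) := by
      intro i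
      rw [Finset.sum_congr rfl fun r _ => hitting_snoc_eq hμb hμh H G i r,
        Finset.sum_add_distrib,
        Finset.sum_congr rfl fun r _ => hitting_copy_boundary_sum hμb hμh H i r,
        ← Finset.mul_sum, Finset.sum_sub_distrib, sum_measure m hμb hμh i, sum_const_words,
        mul_one]
    rw [sum_snoc, Finset.sum_congr rfl fun i _ => inner i, Finset.sum_const, Finset.card_univ,
      ZMod.card, nsmul_eq_mul, hS, hb]
    push_cast
    ring

/-- **Theorem 2.23 (Alekseyev–Berger), third formula, HOLDS** — discharge of the named fact
`AlekseyevBergerIII`: the mean number of random moves from a uniformly random state to a perfect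
state is `(5^n - 2·3^n + 1)/4`.
[cite: HinzKlavzarPetr2018, Ch. 2 §2.2.2 Thm. 2.23 (p. 118)] -/
theorem AlekseyevBergerIII_holds : AlekseyevBergerIII := by
  intro n hn
  obtain ⟨m, rfl⟩ : ∃ m, n = m + 1 := ⟨n - 1, by omega⟩
  obtain ⟨h, H⟩ := exists_hitting (A := perfectWords (m + 1)) (perfectWord_mem (m + 1) 0)
  refine ⟨h, H, ?_⟩
  rw [sum_hitting m H]
  ring

/-! ### §10 Theorem 2.23, second formula: from `0^n` to the prescribed perfect state `2^n` -/

/-- Relabelling by a transposition is an involution. [folklore] -/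
private theorem relabelIso_swap_swap {n : ℕ} (a b : ZMod 3) (f : Fin n → ZMod 3) :
    relabelIso n (Equiv.swap a b) (relabelIso n (Equiv.swap a b) f) = f := by
  funext d
  show Equiv.swap a b (Equiv.swap a b (f d)) = f d
  exact Equiv.swap_apply_self _ _ _

/-- The target `{2^n}` is invariant under the transposition of pegs `0`, `1`. [folklore] -/
private theorem mem_singleton_two_iff_swap01 {n : ℕ} (f : Fin n → ZMod 3) :
    f ∈ ({perfectWord n 2} : Set (Fin n → ZMod 3)) ↔
      relabelIso n (Equiv.swap 0 1) f ∈ ({perfectWord n 2} : Set (Fin n → ZMod 3)) := by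
  simp only [Set.mem_singleton_iff]
  constructor
  · rintro rfl
    rw [relabelIso_perfectWord, show Equiv.swap (0 : ZMod 3) 1 2 = 2 by decide]
  · intro h
    rw [← relabelIso_swap_swap 0 1 f, h, relabelIso_perfectWord,
      show Equiv.swap (0 : ZMod 3) 1 2 = 2 by decide]

/-- The transposition of pegs `0`, `2` carries the target `{0^n}` to `{2^n}`. [folklore] -/
private theorem mem_singleton_zero_iff_swap02 {n : ℕ} (f : Fin n → ZMod 3) :
    f ∈ ({perfectWord n 0} : Set (Fin n → ZMod 3)) ↔
      relabelIso n (Equiv.swap 0 2) f ∈ ({perfectWord n 2} : Set (Fin n → ZMod 3)) := by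
  simp only [Set.mem_singleton_iff]
  constructor
  · rintro rfl
    rw [relabelIso_perfectWord, Equiv.swap_apply_left]
  · intro h
    rw [← relabelIso_swap_swap 0 2 f, h, relabelIso_perfectWord, Equiv.swap_apply_right]

/-- **Decomposition of the hitting time of `{2^n}`**: with `E := E(0^n → 2^n) = E(1^n → 2^n)`,
`h^{2}(f) = h_n(f) + E (μ_0(f) + μ_1(f))`. [folklore] -/
private theorem hittingTwo_decomp (m : ℕ) {μ : ZMod 3 → (Fin (m + 1) → ZMod 3) → ℝ}
    (hμb : ∀ k j, μ k (perfectWord (m + 1) j) = if j = k then 1 else 0)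
    (hμh : ∀ k, ∀ f ∉ perfectWords (m + 1),
      ((moveFinset (m + 1) f).card : ℝ) * μ k f = ∑ g ∈ moveFinset (m + 1) f, μ k g)
    {g : (Fin (m + 1) → ZMod 3) → ℝ}
    (G : IsHittingSolution (m + 1) ({perfectWord (m + 1) 2} : Set (Fin (m + 1) → ZMod 3)) g)
    {h : (Fin (m + 1) → ZMod 3) → ℝ} (H : IsHittingSolution (m + 1) (perfectWords (m + 1)) h)
    (f : Fin (m + 1) → ZMod 3) :
    g f = h f + (g (perfectWord (m + 1) 0) * μ 0 f + g (perfectWord (m + 1) 0) * μ 1 f) := by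
  have hsym : (fun f => g (relabelIso (m + 1) (Equiv.swap 0 1) f)) = g :=
    hittingSolution_unique (A := ({perfectWord (m + 1) 2} : Set (Fin (m + 1) → ZMod 3)))
      (j := 2) (Set.mem_singleton _)
      (isHittingSolution_comp (Equiv.swap 0 1) (fun f => mem_singleton_two_iff_swap01 f) G) G
  have hc1 : g (perfectWord (m + 1) 1) = g (perfectWord (m + 1) 0) := by
    have := congr_fun hsym (perfectWord (m + 1) 0)
    rw [relabelIso_perfectWord, Equiv.swap_apply_left] at this
    exact this
  have hc2 : g (perfectWord (m + 1) 2) = 0 := G.1 _ (Set.mem_singleton _)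
  have key := dirichlet_decomposition hμb hμh (U := g) (w := h)
    (s := fun f => ((moveFinset (m + 1) f).card : ℝ)) H.1 (fun f hf => by linarith [H.2 f hf])
    ?_ f
  · rw [key, sum_univ_zmod3, hc1, hc2]
    ring
  · intro f hf
    have hf2 : f ∉ ({perfectWord (m + 1) 2} : Set (Fin (m + 1) → ZMod 3)) := fun h2 =>
      hf (by rw [Set.mem_singleton_iff.mp h2]; exact perfectWord_mem _ 2)
    linarith [G.2 f hf2]

/-- **The value `E(0^n → 2^n)`**: `E · 2·3^{n-1} = (3^n - 1)(5^n - 3^n)`, from the first-step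
equation at `0^n`, Kac's formula and the invariant `α_n`. [folklore] -/
private theorem hittingTwo_value (m : ℕ) {g : (Fin (m + 1) → ZMod 3) → ℝ}
    (G : IsHittingSolution (m + 1) ({perfectWord (m + 1) 2} : Set (Fin (m + 1) → ZMod 3)) g) :
    g (perfectWord (m + 1) 0) * (2 * 3 ^ m) =
      ((3 : ℝ) ^ (m + 1) - 1) * (5 ^ (m + 1) - 3 ^ (m + 1)) := by
  have hn : 1 ≤ m + 1 := Nat.succ_pos m
  obtain ⟨μ, hμb, hμh⟩ := exists_harmonicMeasure hn
  have hI := alpha_identity m hμb hμh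
  obtain ⟨hν0, hν1, -, -⟩ := corner_measure_sums hn hμb hμh
  obtain ⟨h, H⟩ := exists_hitting (A := perfectWords (m + 1)) (perfectWord_mem (m + 1) 0)
  have hk := kac_sum hn H
  have hc0 : perfectWord (m + 1) 0 ∉ ({perfectWord (m + 1) 2} : Set (Fin (m + 1) → ZMod 3)) :=
    fun h0 => absurd (perfectWord_injective hn (Set.mem_singleton_iff.mp h0)) (by decide)
  have h1 := G.2 _ hc0
  rw [card_moveFinset_perfectWord' hn,
    Finset.sum_congr rfl fun s _ => hittingTwo_decomp m hμb hμh G H s, Finset.sum_add_distrib,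
    Finset.sum_add_distrib, ← Finset.mul_sum, ← Finset.mul_sum, hk, hν0, hν1] at h1
  linear_combination ((5 : ℝ) ^ (m + 1) - 3 ^ (m + 1)) * h1 - g (perfectWord (m + 1) 0) * hI

/-- **Theorem 2.23 (Alekseyev–Berger), second formula, HOLDS** — discharge of the named fact
`AlekseyevBergerII`: from `0^n` randomly to the perfect state `2^n` takes
`(3^n - 1)(5^n - 3^n)/(2·3^{n-1})` moves on average.
[cite: HinzKlavzarPetr2018, Ch. 2 §2.2.2 Thm. 2.23 (p. 118)] -/
theorem AlekseyevBergerII_holds : AlekseyevBergerII := by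
  intro n hn
  obtain ⟨m, rfl⟩ : ∃ m, n = m + 1 := ⟨n - 1, by omega⟩
  obtain ⟨g, G⟩ := exists_hitting (A := ({perfectWord (m + 1) 2} : Set (Fin (m + 1) → ZMod 3)))
    (j := 2) (Set.mem_singleton _)
  refine ⟨g, G, ?_⟩
  have hc0 : perfectWord (m + 1) 0 ∉ ({perfectWord (m + 1) 2} : Set (Fin (m + 1) → ZMod 3)) :=
    fun h0 => absurd (perfectWord_injective hn (Set.mem_singleton_iff.mp h0)) (by decide)
  have h1 := G.2 _ hc0
  have hE : g (perfectWord (m + 1) 0) =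
      ((3 : ℝ) ^ (m + 1) - 1) * (5 ^ (m + 1) - 3 ^ (m + 1)) / (2 * 3 ^ (m + 1 - 1)) := by
    rw [Nat.add_sub_cancel, eq_div_iff (by positivity)]
    exact hittingTwo_value m G
  rw [card_moveFinset_perfectWord' hn] at h1 ⊢
  rw [← hE]
  linarith

/-! ### §11 Theorem 2.23, fourth formula: from a random state to the prescribed perfect state -/

/-- **Theorem 2.23 (Alekseyev–Berger), fourth formula, HOLDS** — discharge of the named fact
`AlekseyevBergerIV`: the mean number of random moves from a uniformly random state to the
perfect state `0^n`.
[cite: HinzKlavzarPetr2018, Ch. 2 §2.2.2 Thm. 2.23 (p. 118)] -/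
theorem AlekseyevBergerIV_holds : AlekseyevBergerIV := by
  intro n hn
  obtain ⟨m, rfl⟩ : ∃ m, n = m + 1 := ⟨n - 1, by omega⟩
  obtain ⟨g, G⟩ := exists_hitting (A := ({perfectWord (m + 1) 2} : Set (Fin (m + 1) → ZMod 3)))
    (j := 2) (Set.mem_singleton _)
  refine ⟨fun f => g (relabelIso (m + 1) (Equiv.swap 0 2) f),
    isHittingSolution_comp (Equiv.swap 0 2) (fun f => mem_singleton_zero_iff_swap02 f) G, ?_⟩
  obtain ⟨μ, hμb, hμh⟩ := exists_harmonicMeasure hn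
  obtain ⟨h, H⟩ := exists_hitting (A := perfectWords (m + 1)) (perfectWord_mem (m + 1) 0)
  have hS := sum_hitting m H
  have hE := hittingTwo_value m G
  have hre : ∑ r, g (relabelIso (m + 1) (Equiv.swap 0 2) r) = ∑ r, g r :=
    Fintype.sum_equiv (relabelIso (m + 1) (Equiv.swap 0 2)).toEquiv _ _ fun _ => rfl
  have hsum : ∑ r, g (relabelIso (m + 1) (Equiv.swap 0 2) r) =
      ∑ r, h r + (g (perfectWord (m + 1) 0) * 3 ^ m + g (perfectWord (m + 1) 0) * 3 ^ m) := by
    rw [hre,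
      Finset.sum_congr rfl fun r _ => hittingTwo_decomp m hμb hμh G H r, Finset.sum_add_distrib,
      Finset.sum_add_distrib, ← Finset.mul_sum, ← Finset.mul_sum, sum_measure m hμb hμh 0,
      sum_measure m hμb hμh 1]
  show (3 : ℝ) ^ (m + 1) * _ = ∑ r, g (relabelIso (m + 1) (Equiv.swap 0 2) r)
  rw [hsum, hS, mul_div_assoc', div_eq_iff (by positivity)]
  linear_combination (-4 * (3 : ℝ) ^ (m + 1)) * hE

/-! ### §12 Theorem 2.23 -/

/-- **Theorem 2.23 (Alekseyev–Berger), HOLDS** — discharge of the named fact `Theorem_2_23`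
(the conjunction of the four formulas).
[cite: HinzKlavzarPetr2018, Ch. 2 §2.2.2 Thm. 2.23 (p. 118)] -/
theorem Theorem_2_23_holds : Theorem_2_23 :=
  ⟨AlekseyevBergerI_holds, AlekseyevBergerII_holds, AlekseyevBergerIII_holds,
    AlekseyevBergerIV_holds⟩

end Literature.Combinatorics.Hinz2018
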